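import Summits.SmoothPoincare4.SmoothPoincare4.Theses.SymplecticOrigami
import Summits.SmoothPoincare4.SmoothPoincare4.Theses.DissolvableGluck
import Summits.SmoothPoincare4.SmoothPoincare4.Theorems.SymplecticOrigamiOrigamiFoldExistenceHelperHostEmbeddingOfGluckTwist
import Summits.SmoothPoincare4.SmoothPoincare4.Theorems.SymplecticOrigamiOrigamiFoldExistenceStubReembedAlongDiffeo
import Summits.SmoothPoincare4.SmoothPoincare4.Theorems.SymplecticOrigamiOrigamiFoldExistenceStubSeamShell
import Literature.Topology.FourManifolds.HomotopyS4CompactProofs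

/-!
# Line `stable-seam-host` (crux `OrigamiFoldExistence`, stmt-SmoothPoincare4-7844), registry v2: links to route `DissolvableGluck`

Lead c10 certificate.  Route `DissolvableGluck` files, as items of its own, exactly the statements
the `ℂℙ²`-widened registry v2 of this line talks to:

* `DissolveOne` (stmt-SmoothPoincare4-17710, crux): every smooth homotopy 4-sphere has a connected
  sum with `ℂℙ²` diffeomorphic to `ℂℙ²`;
* `GluckTwistsStandard` (stmt-SmoothPoincare4-17711, crux): every Gluck twist of `S⁴` is `S⁴`;
* `CP2CancellationOne` (stmt-SmoothPoincare4-17708, the route's TARGET): every `ℂℙ²`-dissolvable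
  smooth homotopy 4-sphere is `S⁴`.

This file records the kernel implications (no new mathematics beyond the landed v2 helpers):

* `helper_hostEmbeddingV2_of_dissolveOne : DissolveOne → stub_hostEmbedding` (v2, verbatim) — so
  STUB 1 v2 is formally WEAKER than BOTH staffed dissolution cruxes of the summit
  (`Stabilisation.StabOneSuffices`, p147741 + p154209, and `DissolvableGluck.DissolveOne`, here);
* `helper_gluckTwistsStandard_of_stableSpheres` (rider) — SR ∧ stable-seam rigidity (the two
  research-open stubs of this line, the transport stubs being landed) ⇒ `GluckTwistsStandard`
  BY NAME;
* `helper_cp2CancellationOne_of_stableSpheres` (rider) — SR ∧ stable-seam rigidity ⇒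
  `CP2CancellationOne` BY NAME: the TARGET of route `DissolvableGluck` follows from this line's two
  stubs about stable 3-spheres in rational surfaces, with no dissolution hypothesis and no appeal
  to `DissolvableIsGluck` (DIG).

No definitions, no named facts, no `sorry`.
-/

noncomputable section

-- the prescribed namespace `Summit.<P>.<Sub>.…` duplicates `SmoothPoincare4` (P = Sub)
set_option linter.dupNamespace false

open scoped Manifold ContDiff Topology RealInnerProductSpace
open Set Function

namespace Summit.SmoothPoincare4.SmoothPoincare4.Theorems.OrigamiFoldExistence.StableSeamHost

open Literature.Topology.FourManifolds

/-- **`DissolvableGluck.DissolveOne ⇒ STUB 1 v2`** (signature of `stub_hostEmbedding` verbatim):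
for a homotopy 4-sphere `S`, `DissolveOne` at `S.carrier` (with `S.nonempty_homotopyEquiv`) gives a
connected sum `P` of `S` with `ℂℙ²` and `Φ : P ≅ ℂℙ²`; conclude by the landed
`helper_hostEmbedding_of_connectedSum_complexProjectivePlane` (host `(P, Φ^* ω_FS)`, rational
through the `ℂℙ²` disjunct). [folklore] -/
theorem helper_hostEmbeddingV2_of_dissolveOne :
    Summit.SmoothPoincare4.SmoothPoincare4.Theses.DissolvableGluck.DissolveOne → ∀ (S : Literature.Topology.FourManifolds.HomotopySphere 4) (e : EuclideanSpace ℝ (Fin 4) → S.carrier), Manifold.IsSmoothEmbedding (𝓡 4) (𝓡 4) ∞ e → ∃ (X : Type) (_ : TopologicalSpace X) (_ : T2Space X) (_ : SecondCountableTopology X) (_ : CompactSpace X) (_ : ChartedSpace (EuclideanSpace ℝ (Fin 4)) X) (_ : IsManifold (𝓡 4) ∞ X) (_ : SimplyConnectedSpace X) (Ω : Literature.Geometry.Kaehler.MForm (𝓡 4) X ℝ 2) (J : S.carrier → X), (Literature.Geometry.Kaehler.IsSmoothForm Ω ∧ Literature.Geometry.Kaehler.IsClosedForm Ω ∧ ∀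 x (v : TangentSpace (𝓡 4) x), v ≠ 0 → ∃ w, Ω x ![v, w] ≠ 0) ∧ (∃ U : Set S.carrier, IsOpen U ∧ (e '' Metric.ball (0 : EuclideanSpace ℝ (Fin 4)) 1)ᶜ ⊆ U ∧ ContMDiffOn (𝓡 4) (𝓡 4) ∞ J U ∧ Set.InjOn J U ∧ ∀ x ∈ U, Function.Bijective (mfderiv (𝓡 4) (𝓡 4) J x)) ∧ ((∃ c c' : (Metric.sphere (0 : EuclideanSpace ℝ (Fin 3)) 1) → X, (Manifold.IsSmoothEmbedding (𝓡 2) (𝓡 4) ∞ c ∧ (∀ y (v : TangentSpace (𝓡 2) y), v ≠ 0 → ∃ w : TangentSpace (𝓡 2) y, Ω (c y) ![mfderiv (𝓡 2) (𝓡 4) c y v, mfderiv (𝓡 2) (𝓡 4) c y w] ≠ 0) ∧ Manifold.IsSmoothEmbedding (𝓡 2) (𝓡 4) ∞ c' ∧ Disjoint (Set.range c) (Set.range c') ∧ ∃ H : unitInterval × (Metric.sphere (0 : EuclideanSpace ℝ (Fin 3)) 1) → X, Continuous H ∧ ∀ y, H (0, y) = c y ∧ H (1, y) = c' y)) ∨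 (∃ (Ψ : X ≃ₘ⟮𝓡 4, 𝓡 4⟯ Literature.Topology.FourManifolds.ComplexProjectivePlane) (a : ℝ), 0 < a ∧ ∀ x (v w : TangentSpace (𝓡 4) x), Ω x ![v, w] = a * Literature.Geometry.Kaehler.CPn.fsForm 2 (Ψ x) ![mfderiv (𝓡 4) (𝓡 4) Ψ x v, mfderiv (𝓡 4) (𝓡 4) Ψ x w])) := by
  intro hD S e he
  obtain ⟨f⟩ := S.nonempty_homotopyEquiv
  obtain ⟨P, _, _, _, _, _, hCS, hΦ⟩ := hD S.carrier f
  exact helper_hostEmbedding_of_connectedSum_complexProjectivePlane S e he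
    ⟨P, inferInstance, inferInstance, inferInstance, hCS, hΦ⟩

/-- **SR ∧ stable-seam rigidity ⇒ the Gluck twist conjecture** (route `DissolvableGluck`'s crux
`GluckTwistsStandard`, stmt-SmoothPoincare4-17711, BY NAME): the landed rider
`helper_gluckTwist_diffeomorph_sphere_of_stableSpheres` with its two transport hypotheses
discharged by the landed `stub_reembedAlongDiffeo` (p154047) and `stub_seamShell` (p154126).
[cite: GluckTAMS1962, §17] -/
theorem helper_gluckTwistsStandard_of_stableSpheres :
    (∀ (X : Type) [TopologicalSpace X] [T2Space X] [SecondCountableTopology X] [CompactSpace X] [ChartedSpace (EuclideanSpace ℝ (Fin 4)) X] [IsManifold (𝓡 4) ∞ X] [SimplyConnectedSpace X] (Ω : Literature.Geometry.Kaehler.MForm (𝓡 4) X ℝ 2) (g : EuclideanSpace ℝ (Fin 4) → X), (Literature.Geometry.Kaehler.IsSmoothForm Ω ∧ Literature.Geometry.Kaehler.IsClosedForm Ω ∧ ∀ x (v : TangentSpace (𝓡 4) x), v ≠ 0 → ∃ w, Ω x ![v, w] ≠ 0) → ((∃ c c' : (Metric.sphere (0 : EuclideanSpace ℝ (Fin 3))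 1) → X, (Manifold.IsSmoothEmbedding (𝓡 2) (𝓡 4) ∞ c ∧ (∀ y (v : TangentSpace (𝓡 2) y), v ≠ 0 → ∃ w : TangentSpace (𝓡 2) y, Ω (c y) ![mfderiv (𝓡 2) (𝓡 4) c y v, mfderiv (𝓡 2) (𝓡 4) c y w] ≠ 0) ∧ Manifold.IsSmoothEmbedding (𝓡 2) (𝓡 4) ∞ c' ∧ Disjoint (Set.range c) (Set.range c') ∧ ∃ H : unitInterval × (Metric.sphere (0 : EuclideanSpace ℝ (Fin 3)) 1) → X, Continuous H ∧ ∀ y, H (0, y) = c y ∧ H (1, y) = c' y)) ∨ (∃ (Ψ : X ≃ₘ⟮𝓡 4, 𝓡 4⟯ Literature.Topology.FourManifolds.ComplexProjectivePlane) (a : ℝ), 0 < a ∧ ∀ x (v w : TangentSpace (𝓡 4) x), Ω x ![v, w] = a * Literature.Geometry.Kaehler.CPn.fsForm 2 (Ψ x) ![mfderiv (𝓡 4) (𝓡 4) Ψ x v, mfderiv (𝓡 4) (𝓡 4) Ψ x w])) → (∃ V : Set (EuclideanSpace ℝ (Fin 4)), IsOpen V ∧ Metric.sphere (0 : EuclideanSpace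 ℝ (Fin 4)) 1 ⊆ V ∧ ContMDiffOn (𝓡 4) (𝓡 4) ∞ g V ∧ Set.InjOn g V ∧ ∀ u ∈ V, Function.Bijective (mfderiv (𝓡 4) (𝓡 4) g u)) → ∃ (φ : X ≃ₘ⟮𝓡 4, 𝓡 4⟯ X) (θ : EuclideanSpace ℝ (Fin 4) → EuclideanSpace ℝ (Fin 4) →L[ℝ] ℝ), (ContDiff ℝ ∞ θ ∧ (∀ u : EuclideanSpace ℝ (Fin 4), ‖u‖ = 1 → ∀ v : Fin 3 → EuclideanSpace ℝ (Fin 4), (∀ i, ⟪v i, u⟫ = 0) → LinearIndependent ℝ v → θ u (v 0) * Ω ((φ ∘ g) u) ![mfderiv (𝓡 4) (𝓡 4) (φ ∘ g) u (v 1), mfderiv (𝓡 4) (𝓡 4) (φ ∘ g) u (v 2)] - θ u (v 1) * Ω ((φ ∘ g) u) ![mfderiv (𝓡 4) (𝓡 4) (φ ∘ g) u (v 0), mfderiv (𝓡 4) (𝓡 4) (φ ∘ g) u (v 2)] + θ u (v 2) * Ω ((φ ∘ g) u) ![mfderiv (𝓡 4) (𝓡 4) (φ ∘ g) u (v 0),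 mfderiv (𝓡 4) (𝓡 4) (φ ∘ g) u (v 1)] ≠ 0) ∧ (∀ u : EuclideanSpace ℝ (Fin 4), ‖u‖ = 1 → ∀ v : EuclideanSpace ℝ (Fin 4), ⟪v, u⟫ = 0 → (∀ w : EuclideanSpace ℝ (Fin 4), ⟪w, u⟫ = 0 → Ω ((φ ∘ g) u) ![mfderiv (𝓡 4) (𝓡 4) (φ ∘ g) u v, mfderiv (𝓡 4) (𝓡 4) (φ ∘ g) u w] = 0) → ∀ w : EuclideanSpace ℝ (Fin 4), ⟪w, u⟫ = 0 → fderiv ℝ θ u v w - fderiv ℝ θ u w v = 0))) → (∀ (S : Literature.Topology.FourManifolds.HomotopySphere 4) (e : EuclideanSpace ℝ (Fin 4) → S.carrier) (X : Type) [TopologicalSpace X] [T2Space X] [SecondCountableTopology X] [CompactSpace X] [ChartedSpace (EuclideanSpace ℝ (Fin 4)) X] [IsManifold (𝓡 4) ∞ X] [SimplyConnectedSpace X] (Ω : Literature.Geometry.Kaehler.MForm (𝓡 4) X ℝ 2) (J : S.carrier → X) (θ : EuclideanSpace ℝ (Fin 4) → EuclideanSpace ℝ (Fin 4) →L[ℝ]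 ℝ), Manifold.IsSmoothEmbedding (𝓡 4) (𝓡 4) ∞ e → (Literature.Geometry.Kaehler.IsSmoothForm Ω ∧ Literature.Geometry.Kaehler.IsClosedForm Ω ∧ ∀ x (v : TangentSpace (𝓡 4) x), v ≠ 0 → ∃ w, Ω x ![v, w] ≠ 0) → (∃ U : Set S.carrier, IsOpen U ∧ (e '' Metric.ball (0 : EuclideanSpace ℝ (Fin 4)) 1)ᶜ ⊆ U ∧ ContMDiffOn (𝓡 4) (𝓡 4) ∞ J U ∧ Set.InjOn J U ∧ ∀ x ∈ U, Function.Bijective (mfderiv (𝓡 4) (𝓡 4) J x)) → ((∃ c c' : (Metric.sphere (0 : EuclideanSpace ℝ (Fin 3)) 1) → X, (Manifold.IsSmoothEmbedding (𝓡 2) (𝓡 4) ∞ c ∧ (∀ y (v : TangentSpace (𝓡 2) y), v ≠ 0 → ∃ w : TangentSpace (𝓡 2) y, Ω (c y) ![mfderiv (𝓡 2) (𝓡 4) c y v, mfderiv (𝓡 2) (𝓡 4) c y w] ≠ 0) ∧ Manifold.IsSmoothEmbedding (𝓡 2) (𝓡 4) ∞ c' ∧ Disjoint (Set.range c) (Set.range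 c') ∧ ∃ H : unitInterval × (Metric.sphere (0 : EuclideanSpace ℝ (Fin 3)) 1) → X, Continuous H ∧ ∀ y, H (0, y) = c y ∧ H (1, y) = c' y)) ∨ (∃ (Ψ : X ≃ₘ⟮𝓡 4, 𝓡 4⟯ Literature.Topology.FourManifolds.ComplexProjectivePlane) (a : ℝ), 0 < a ∧ ∀ x (v w : TangentSpace (𝓡 4) x), Ω x ![v, w] = a * Literature.Geometry.Kaehler.CPn.fsForm 2 (Ψ x) ![mfderiv (𝓡 4) (𝓡 4) Ψ x v, mfderiv (𝓡 4) (𝓡 4) Ψ x w])) → (ContDiff ℝ ∞ θ ∧ (∀ u : EuclideanSpace ℝ (Fin 4), ‖u‖ = 1 → ∀ v : Fin 3 → EuclideanSpace ℝ (Fin 4), (∀ i, ⟪v i, u⟫ = 0) → LinearIndependent ℝ v → θ u (v 0) * Ω ((J ∘ e) u) ![mfderiv (𝓡 4) (𝓡 4) (J ∘ e) u (v 1), mfderiv (𝓡 4) (𝓡 4) (J ∘ e) u (v 2)] - θ u (v 1) * Ω ((J ∘ e) u) ![mfderiv (𝓡 4) (𝓡 4) (J ∘ e) u (v 0), mfderiv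 (𝓡 4) (𝓡 4) (J ∘ e) u (v 2)] + θ u (v 2) * Ω ((J ∘ e) u) ![mfderiv (𝓡 4) (𝓡 4) (J ∘ e) u (v 0), mfderiv (𝓡 4) (𝓡 4) (J ∘ e) u (v 1)] ≠ 0) ∧ (∀ u : EuclideanSpace ℝ (Fin 4), ‖u‖ = 1 → ∀ v : EuclideanSpace ℝ (Fin 4), ⟪v, u⟫ = 0 → (∀ w : EuclideanSpace ℝ (Fin 4), ⟪w, u⟫ = 0 → Ω ((J ∘ e) u) ![mfderiv (𝓡 4) (𝓡 4) (J ∘ e) u v, mfderiv (𝓡 4) (𝓡 4) (J ∘ e) u w] = 0) → ∀ w : EuclideanSpace ℝ (Fin 4), ⟪w, u⟫ = 0 → fderiv ℝ θ u v w - fderiv ℝ θ u w v = 0)) → Nonempty (S.carrier ≃ₘ⟮𝓡 4, 𝓡 4⟯ Metric.sphere (0 : EuclideanSpace ℝ (Fin 5)) 1)) → Summit.SmoothPoincare4.SmoothPoincare4.Theses.DissolvableGluck.GluckTwistsStandard :=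
  fun hSR h3 => helper_gluckTwist_diffeomorph_sphere_of_stableSpheres hSR
    stub_reembedAlongDiffeo stub_seamShell h3

/-- **SR ∧ stable-seam rigidity ⇒ `CP2CancellationOne`** (the TARGET of route `DissolvableGluck`,
stmt-SmoothPoincare4-17708, BY NAME): a smooth `M ≃ₕ S⁴` is compact and orientable (tree
theorems), hence a `HomotopySphere 4`; a chart ball (`stub_chartEmbedding`, p87331); the given
`ℂℙ²`-dissolution of `M` yields the rational host (`helper_hostEmbedding_of_connectedSum_complexProjectivePlane`);
SR re-embeds with stable seam (transport stubs landed); rigidity gives `M ≅ S⁴`. [folklore] -/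
theorem helper_cp2CancellationOne_of_stableSpheres :
    (∀ (X : Type) [TopologicalSpace X] [T2Space X] [SecondCountableTopology X] [CompactSpace X] [ChartedSpace (EuclideanSpace ℝ (Fin 4)) X] [IsManifold (𝓡 4) ∞ X] [SimplyConnectedSpace X] (Ω : Literature.Geometry.Kaehler.MForm (𝓡 4) X ℝ 2) (g : EuclideanSpace ℝ (Fin 4) → X), (Literature.Geometry.Kaehler.IsSmoothForm Ω ∧ Literature.Geometry.Kaehler.IsClosedForm Ω ∧ ∀ x (v : TangentSpace (𝓡 4) x), v ≠ 0 → ∃ w, Ω x ![v, w] ≠ 0) → ((∃ c c' : (Metric.sphere (0 : EuclideanSpace ℝ (Fin 3)) 1) → X, (Manifold.IsSmoothEmbedding (𝓡 2) (𝓡 4) ∞ c ∧ (∀ y (v : TangentSpace (𝓡 2) y), v ≠ 0 → ∃ w : TangentSpace (𝓡 2) y, Ω (c y) ![mfderiv (𝓡 2) (𝓡 4) c y v, mfderiv (𝓡 2) (𝓡 4) c y w] ≠ 0) ∧ Manifold.IsSmoothEmbedding (𝓡 2) (𝓡 4) ∞ c' ∧ Disjoint (Set.range c) (Set.range c') ∧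 ∃ H : unitInterval × (Metric.sphere (0 : EuclideanSpace ℝ (Fin 3)) 1) → X, Continuous H ∧ ∀ y, H (0, y) = c y ∧ H (1, y) = c' y)) ∨ (∃ (Ψ : X ≃ₘ⟮𝓡 4, 𝓡 4⟯ Literature.Topology.FourManifolds.ComplexProjectivePlane) (a : ℝ), 0 < a ∧ ∀ x (v w : TangentSpace (𝓡 4) x), Ω x ![v, w] = a * Literature.Geometry.Kaehler.CPn.fsForm 2 (Ψ x) ![mfderiv (𝓡 4) (𝓡 4) Ψ x v, mfderiv (𝓡 4) (𝓡 4) Ψ x w])) → (∃ V : Set (EuclideanSpace ℝ (Fin 4)), IsOpen V ∧ Metric.sphere (0 : EuclideanSpace ℝ (Fin 4)) 1 ⊆ V ∧ ContMDiffOn (𝓡 4) (𝓡 4) ∞ g V ∧ Set.InjOn g V ∧ ∀ u ∈ V, Function.Bijective (mfderiv (𝓡 4) (𝓡 4) g u)) → ∃ (φ : X ≃ₘ⟮𝓡 4, 𝓡 4⟯ X) (θ : EuclideanSpace ℝ (Fin 4) → EuclideanSpace ℝ (Fin 4) →L[ℝ] ℝ), (ContDiff ℝ ∞ θ ∧ (∀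 u : EuclideanSpace ℝ (Fin 4), ‖u‖ = 1 → ∀ v : Fin 3 → EuclideanSpace ℝ (Fin 4), (∀ i, ⟪v i, u⟫ = 0) → LinearIndependent ℝ v → θ u (v 0) * Ω ((φ ∘ g) u) ![mfderiv (𝓡 4) (𝓡 4) (φ ∘ g) u (v 1), mfderiv (𝓡 4) (𝓡 4) (φ ∘ g) u (v 2)] - θ u (v 1) * Ω ((φ ∘ g) u) ![mfderiv (𝓡 4) (𝓡 4) (φ ∘ g) u (v 0), mfderiv (𝓡 4) (𝓡 4) (φ ∘ g) u (v 2)] + θ u (v 2) * Ω ((φ ∘ g) u) ![mfderiv (𝓡 4) (𝓡 4) (φ ∘ g) u (v 0), mfderiv (𝓡 4) (𝓡 4) (φ ∘ g) u (v 1)] ≠ 0) ∧ (∀ u : EuclideanSpace ℝ (Fin 4), ‖u‖ = 1 → ∀ v : EuclideanSpace ℝ (Fin 4), ⟪v, u⟫ = 0 → (∀ w : EuclideanSpace ℝ (Fin 4), ⟪w, u⟫ = 0 → Ω ((φ ∘ g) u) ![mfderiv (𝓡 4) (𝓡 4) (φ ∘ g) u v, mfderiv (𝓡 4) (𝓡 4)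 (φ ∘ g) u w] = 0) → ∀ w : EuclideanSpace ℝ (Fin 4), ⟪w, u⟫ = 0 → fderiv ℝ θ u v w - fderiv ℝ θ u w v = 0))) → (∀ (S : Literature.Topology.FourManifolds.HomotopySphere 4) (e : EuclideanSpace ℝ (Fin 4) → S.carrier) (X : Type) [TopologicalSpace X] [T2Space X] [SecondCountableTopology X] [CompactSpace X] [ChartedSpace (EuclideanSpace ℝ (Fin 4)) X] [IsManifold (𝓡 4) ∞ X] [SimplyConnectedSpace X] (Ω : Literature.Geometry.Kaehler.MForm (𝓡 4) X ℝ 2) (J : S.carrier → X) (θ : EuclideanSpace ℝ (Fin 4) → EuclideanSpace ℝ (Fin 4) →L[ℝ] ℝ), Manifold.IsSmoothEmbedding (𝓡 4) (𝓡 4) ∞ e → (Literature.Geometry.Kaehler.IsSmoothForm Ω ∧ Literature.Geometry.Kaehler.IsClosedForm Ω ∧ ∀ x (v : TangentSpace (𝓡 4) x), v ≠ 0 → ∃ w, Ω x ![v, w] ≠ 0) → (∃ U : Set S.carrier, IsOpen U ∧ (e '' Metric.ball (0 : EuclideanSpace ℝ (Fin 4)) 1)ᶜ ⊆ U ∧ ContMDiffOn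 (𝓡 4) (𝓡 4) ∞ J U ∧ Set.InjOn J U ∧ ∀ x ∈ U, Function.Bijective (mfderiv (𝓡 4) (𝓡 4) J x)) → ((∃ c c' : (Metric.sphere (0 : EuclideanSpace ℝ (Fin 3)) 1) → X, (Manifold.IsSmoothEmbedding (𝓡 2) (𝓡 4) ∞ c ∧ (∀ y (v : TangentSpace (𝓡 2) y), v ≠ 0 → ∃ w : TangentSpace (𝓡 2) y, Ω (c y) ![mfderiv (𝓡 2) (𝓡 4) c y v, mfderiv (𝓡 2) (𝓡 4) c y w] ≠ 0) ∧ Manifold.IsSmoothEmbedding (𝓡 2) (𝓡 4) ∞ c' ∧ Disjoint (Set.range c) (Set.range c') ∧ ∃ H : unitInterval × (Metric.sphere (0 : EuclideanSpace ℝ (Fin 3)) 1) → X, Continuous H ∧ ∀ y, H (0, y) = c y ∧ H (1, y) = c' y)) ∨ (∃ (Ψ : X ≃ₘ⟮𝓡 4, 𝓡 4⟯ Literature.Topology.FourManifolds.ComplexProjectivePlane) (a : ℝ), 0 < a ∧ ∀ x (v w : TangentSpace (𝓡 4) x), Ω x ![v, w] = a * Literature.Geometry.Kaehler.CPn.fsForm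 2 (Ψ x) ![mfderiv (𝓡 4) (𝓡 4) Ψ x v, mfderiv (𝓡 4) (𝓡 4) Ψ x w])) → (ContDiff ℝ ∞ θ ∧ (∀ u : EuclideanSpace ℝ (Fin 4), ‖u‖ = 1 → ∀ v : Fin 3 → EuclideanSpace ℝ (Fin 4), (∀ i, ⟪v i, u⟫ = 0) → LinearIndependent ℝ v → θ u (v 0) * Ω ((J ∘ e) u) ![mfderiv (𝓡 4) (𝓡 4) (J ∘ e) u (v 1), mfderiv (𝓡 4) (𝓡 4) (J ∘ e) u (v 2)] - θ u (v 1) * Ω ((J ∘ e) u) ![mfderiv (𝓡 4) (𝓡 4) (J ∘ e) u (v 0), mfderiv (𝓡 4) (𝓡 4) (J ∘ e) u (v 2)] + θ u (v 2) * Ω ((J ∘ e) u) ![mfderiv (𝓡 4) (𝓡 4) (J ∘ e) u (v 0), mfderiv (𝓡 4) (𝓡 4) (J ∘ e) u (v 1)] ≠ 0) ∧ (∀ u : EuclideanSpace ℝ (Fin 4), ‖u‖ = 1 → ∀ v : EuclideanSpace ℝ (Fin 4), ⟪v, u⟫ = 0 → (∀ w : EuclideanSpace ℝ (Fin 4), ⟪w,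 u⟫ = 0 → Ω ((J ∘ e) u) ![mfderiv (𝓡 4) (𝓡 4) (J ∘ e) u v, mfderiv (𝓡 4) (𝓡 4) (J ∘ e) u w] = 0) → ∀ w : EuclideanSpace ℝ (Fin 4), ⟪w, u⟫ = 0 → fderiv ℝ θ u v w - fderiv ℝ θ u w v = 0)) → Nonempty (S.carrier ≃ₘ⟮𝓡 4, 𝓡 4⟯ Metric.sphere (0 : EuclideanSpace ℝ (Fin 5)) 1)) → Summit.SmoothPoincare4.SmoothPoincare4.Theses.DissolvableGluck.CP2CancellationOne := by
  intro hSR h3 M _ _ _ _ _ hM hP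
  haveI : CompactSpace M := compactSpace_of_homotopyEquiv_sphere_four_holds M hM
  obtain ⟨o⟩ := isOrientable_of_homotopyEquiv_sphere_four_holds M hM
  let S : HomotopySphere 4 := ⟨M, o, ⟨hM⟩⟩
  obtain ⟨e, he⟩ :=
    Summit.SmoothPoincare4.SmoothPoincare4.Theorems.OrigamiFoldExistence.RoundTraceContinuity.stub_chartEmbedding S
  obtain ⟨P, _, _, _, _, _, hCS, hΦ⟩ := hP
  obtain ⟨Y, _, _, _, _, _, _, _, Ω, J, hΩ, hJ, hY⟩ :=
    helper_hostEmbedding_of_connectedSum_complexProjectivePlane S e he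
      ⟨P, inferInstance, inferInstance, inferInstance, hCS, hΦ⟩
  obtain ⟨φ, θ, hθ⟩ := hSR Y Ω (J ∘ e) hΩ hY (stub_seamShell S e Y J he hJ)
  exact h3 S e Y Ω (φ ∘ J) θ he hΩ (stub_reembedAlongDiffeo S e Y Y J φ hJ) hY hθ

end Summit.SmoothPoincare4.SmoothPoincare4.Theorems.OrigamiFoldExistence.StableSeamHost

end
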